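import Summits.QuantumFields.YangMills.Theorems.BalabanUVNodesN08HaarCompatibilityGuardCoreLawSUN
import Summits.QuantumFields.YangMills.Theorems.BalabanUVNodesN08HaarCompatibilityGuardMonotoneInjectiveSUNSlot

/-!
# BalabanUVNodes ∕ N08 — THE LAW OF THE PRINTED CORE MAP ON `SU(N)` UNDER HAAR IS `≤ ((1 − Σcᵢ)^{−(N²−1)} + 1)•HAAR`, AN EXPLICIT CONSTANT FOR EVERY `N`
# (piece (v-b) of the general-`N` monotone height: global injectivity turns g5's existential window count into ONE sheet)

WIDTH SEAT `pub-ymgap-dag-n08-w6` g6 (R399 (3a); CLAIM-1 of record HOME INBOX l.38866), 2026-08-28.  Track A, DAG node N08 = [Balaban1985UV3] Thm 1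
p. 257 (compact) + Thm 2 p. 272; the typed (0.4) averaging and its guard = [Balaban1987RG1] (0.4) p. 253; key item K1⁷ `StabilityBAtRecordR13SepCoPH`
(stmt-QuantumFields-20542), `--supports … --as helper`.  COUNT-NEUTRAL.

THE POINT.  g5's `…GuardCoreLawSUN.exists_map_haar_le_of_kmat_on_open` bounds `Haar∘Φ⁻¹` by `(m⁻¹·#cover + 1)•Haar` with an EXISTENTIAL finite cover count
(`m = (1 − Σcᵢ)^{N²−1}` the Jacobian floor of g4's pinch).  When `Φ` is INJECTIVE on the guarded set — part (v-a) `…MonotoneInjectiveSUNSlot.injOn_of_eq_kmat_deltaSU`,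
every `N`, `Σcᵢ ≤ 1 − 1∕300` — the windows need not be counted: disjointify the cover and feed each piece the target `A ∩ Φ(piece)`; the images are disjoint and Borel
(Lusin–Souslin).  §1 [folklore] abstract pieces (`mul_measure_inter_preimage_le_image`, `map_restrict_le_smul_of_injOn`); §2 the injective edition of g5's frame for a
log-charted compact group (`haar_map_le_of_windows_injOn`: `μ∘Φ⁻¹ ≤ (m⁻¹ + 1)•μ`); §3 ★★★ `map_haar_le_of_kmat_on_open`: for `cᵢ ≥ 0`, `Σcᵢ ≤ 1 − 1∕300`, every
family `V : ι → SU(N)`, every OPEN guarded `O` and every Borel `Φ` with `Φ = Kmat V c` on `O`, `id` off `O`:  **`Haar∘Φ⁻¹ ≤ ((1 − Σcᵢ)^{−(N²−1)} + 1)•Haar`**.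

HONEST FRAMING.  Count-neutral helper ([folklore] measure theory BY IMPORT; g5's proof re-run); RANGE `Σcᵢ ≤ 1 − 1∕300`; ONE RG step — the k-uniform `hmass` is NOT
supplied; E6′ NOT decided; nothing of Bałaban's asserted; N08 NOT discharged; counts unmoved (typed 28∕28 · discharged 5∕27); no summit statement is proved by this seat
— R4 closes the CONDITIONAL rung `BalabanLadder.UV` only; the Yang–Mills mass gap (Clay) is NOT proved by any of this; nothing continuum ∕ ℝ⁴ ∕ OS.
0 `sorry`, 0 `def`, 0 `instance`, 0 `notation`, standard axioms.
-/

noncomputable section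

open NormedSpace MeasureTheory Set Function Filter Topology
open scoped ENNReal NNReal Matrix Matrix.Norms.L2Operator

namespace Summit.QuantumFields.YangMills.BalabanUVNodes.N08HaarCompatibilityGuardCoreLawSUNExplicit

section Pieces

variable {α : Type*} [MeasurableSpace α] (μ : Measure α)

/-- **WINDOWS ADD UP WITHOUT MULTIPLICITY WHEN `ψ` IS INJECTIVE.**  If `S₀` is covered by finitely many measurable pieces `V_k`, `k ∈ K`, each obeying
`m·μ(V_k ∩ ψ⁻¹B) ≤ μ(B)` for all measurable `B`, and `ψ` is injective on `S₀` with measurable images of measurable subsets, then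
`m·μ(S ∩ ψ⁻¹A) ≤ μ(A ∩ ψ(S))` for every measurable `S ⊆ S₀` — disjointify the cover and feed each piece the target `A ∩ ψ(piece)`. [folklore] -/
theorem mul_measure_inter_preimage_le_image {ι : Type*} (K : Finset ι) (V : ι → Set α) (hVm : ∀ k ∈ K, MeasurableSet (V k))
    {ψ : α → α} {m : ℝ≥0∞} (hV : ∀ k ∈ K, ∀ B, MeasurableSet B → m * μ (V k ∩ ψ ⁻¹' B) ≤ μ B)
    {S₀ : Set α} (hinj : InjOn ψ S₀) (himg : ∀ E, E ⊆ S₀ → MeasurableSet E → MeasurableSet (ψ '' E))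
    {S : Set α} (hSm : MeasurableSet S) (hSS₀ : S ⊆ S₀) (hS : S ⊆ ⋃ k ∈ K, V k)
    {A : Set α} (hA : MeasurableSet A) : m * μ (S ∩ ψ ⁻¹' A) ≤ μ (A ∩ ψ '' S) := by
  classical
  induction K using Finset.induction_on generalizing S with
  | empty =>
    have hS0 : S = ∅ := by simpa using hS
    simp [hS0]
  | @insert k K hk ih =>
    -- split `S` into the piece in `V k` and the rest
    have hVk : MeasurableSet (V k) := hVm k (Finset.mem_insert_self k K)
    have hS1m : MeasurableSet (S ∩ V k) := hSm.inter hVk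
    have hS2m : MeasurableSet (S \ V k) := hSm.diff hVk
    have hS2 : S \ V k ⊆ ⋃ j ∈ K, V j := by
      intro x hx
      have := hS hx.1
      simp only [Finset.mem_insert, mem_iUnion, exists_prop] at this
      obtain ⟨j, hj, hxj⟩ := this
      rcases hj with rfl | hj
      · exact absurd hxj hx.2
      · exact mem_iUnion₂.2 ⟨j, hj, hxj⟩
    have ih' := ih (fun j hj => hVm j (Finset.mem_insert_of_mem hj)) (fun j hj => hV j (Finset.mem_insert_of_mem hj)) hS2m
      (sdiff_subset.trans hSS₀) hS2
    -- the piece in `V k`, with target `A ∩ ψ(S ∩ V k)`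
    have hI1 : MeasurableSet (ψ '' (S ∩ V k)) := himg _ (inter_subset_left.trans hSS₀) hS1m
    have hI2 : MeasurableSet (ψ '' (S \ V k)) := himg _ (sdiff_subset.trans hSS₀) hS2m
    have h1 : m * μ (S ∩ V k ∩ ψ ⁻¹' A) ≤ μ (A ∩ ψ '' (S ∩ V k)) := by
      have hsub : S ∩ V k ∩ ψ ⁻¹' A ⊆ V k ∩ ψ ⁻¹' (A ∩ ψ '' (S ∩ V k)) := by
        rintro x ⟨⟨hxS, hxV⟩, hxA⟩
        exact ⟨hxV, hxA, x, ⟨hxS, hxV⟩, rfl⟩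
      calc m * μ (S ∩ V k ∩ ψ ⁻¹' A) ≤ m * μ (V k ∩ ψ ⁻¹' (A ∩ ψ '' (S ∩ V k))) := mul_le_mul' le_rfl (measure_mono hsub)
        _ ≤ μ (A ∩ ψ '' (S ∩ V k)) := hV k (Finset.mem_insert_self k K) _ (hA.inter hI1)
    -- the two images are disjoint and fill `ψ(S)`
    have hdisj : Disjoint (A ∩ ψ '' (S ∩ V k)) (A ∩ ψ '' (S \ V k)) := by
      refine Disjoint.mono inter_subset_right inter_subset_right (disjoint_left.2 ?_)
      rintro _ ⟨x, hx, rfl⟩ ⟨y, hy, hxy⟩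
      have : y = x := hinj (hSS₀ hy.1) (hSS₀ hx.1) hxy
      subst this
      exact hy.2 hx.2
    have hunion : A ∩ ψ '' (S ∩ V k) ∪ A ∩ ψ '' (S \ V k) = A ∩ ψ '' S := by
      rw [← inter_union_distrib_left, ← image_union, inter_union_sdiff]
    have hsplit : S ∩ ψ ⁻¹' A = (S ∩ V k ∩ ψ ⁻¹' A) ∪ ((S \ V k) ∩ ψ ⁻¹' A) := by
      rw [← union_inter_distrib_right, inter_union_sdiff]
    calc m * μ (S ∩ ψ ⁻¹' A) ≤ m * (μ (S ∩ V k ∩ ψ ⁻¹' A) + μ ((S \ V k) ∩ ψ ⁻¹' A)) := by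
          rw [hsplit]; exact mul_le_mul' le_rfl (measure_union_le _ _)
      _ = m * μ (S ∩ V k ∩ ψ ⁻¹' A) + m * μ ((S \ V k) ∩ ψ ⁻¹' A) := mul_add _ _ _
      _ ≤ μ (A ∩ ψ '' (S ∩ V k)) + μ (A ∩ ψ '' (S \ V k)) := add_le_add h1 ih'
      _ = μ (A ∩ ψ '' S) := by rw [← measure_union hdisj (hA.inter hI2), hunion]

/-- … hence `m·μ(S ∩ ψ⁻¹A) ≤ μ(A)` (NO factor `#K`), and `(μ↾S)∘ψ⁻¹ ≤ m⁻¹ • μ` for `0 < m < ∞`. [folklore] -/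
theorem map_restrict_le_smul_of_injOn {ι : Type*} (K : Finset ι) (V : ι → Set α) (hVm : ∀ k ∈ K, MeasurableSet (V k))
    {ψ : α → α} (hψ : Measurable ψ) {m : ℝ≥0∞} (hm0 : m ≠ 0) (hmt : m ≠ ∞)
    (hV : ∀ k ∈ K, ∀ B, MeasurableSet B → m * μ (V k ∩ ψ ⁻¹' B) ≤ μ B)
    {S : Set α} (hSm : MeasurableSet S) (hinj : InjOn ψ S) (himg : ∀ E, E ⊆ S → MeasurableSet E → MeasurableSet (ψ '' E))
    (hS : S ⊆ ⋃ k ∈ K, V k) : (μ.restrict S).map ψ ≤ m⁻¹ • μ := by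
  have h := N08HaarCompatibilityGuardChartTransfer.map_restrict_le_smul μ hψ (S := S) (c := 1) hm0 hmt (fun A hA => by
    rw [one_mul]
    exact (mul_measure_inter_preimage_le_image μ K V hVm hV hinj himg hSm Subset.rfl hS hA).trans (measure_mono inter_subset_left))
  simpa using h

end Pieces

/-! ## §2 The frame for a log-charted compact group, injective edition: `μ∘Φ⁻¹ ≤ (m⁻¹ + 1)•μ` -/

section Frame

open Literature.MathematicalPhysics.QuantumFieldTheory.Balaban1983to89
open Literature.MathematicalPhysics.QuantumFieldTheory.Balaban1983to89.HaarExponentialChart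
open Literature.MathematicalPhysics.QuantumFieldTheory.Balaban1983to89.HaarExponentialChart.IsChartRep (chartRadius)
open Literature.MathematicalPhysics.QuantumFieldTheory.Balaban1983to89.B13HaarSigmaJacobian (jac)
open Summit.QuantumFields.YangMills.BalabanUVNodes.N08HaarCompatibilityGuardIntrinsicJacobian
open Summit.QuantumFields.YangMills.BalabanUVNodes.N08HaarCompatibilityGuardChartTransfer (map_le_smul_of_restrict)

variable {𝔸 : Type*} [NormedRing 𝔸] [NormedAlgebra ℂ 𝔸] [CompleteSpace 𝔸]
variable {G : Type*} [Group G] [TopologicalSpace G] [IsTopologicalGroup G] [CompactSpace G]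
variable {C : LogChart 𝔸} {ρ : G →* 𝔸} (h : IsChartRep C ρ) [FiniteDimensional ℝ C.lie]
  (hlie : ∀ x ∈ C.lie, ∀ y ∈ C.lie, x * y - y * x ∈ C.lie)
variable [MeasurableSpace C.lie] [BorelSpace C.lie]
variable [MeasurableSpace G] [BorelSpace G] (μ : Measure G) [μ.IsHaarMeasure]

/-- ★★ **THE INJECTIVE FRAME**: as in g5's `haar_map_le_of_windows_id` (finitely many translated chart windows `w₀(k)·Θ(Ω_k)` covering the measurable
set `S`, chart conjugates `ψ_k` injective and differentiable on `Ω_k` with the common Jacobian floor `m`, `Φ = id` off `S`), plus: the window pieces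
are measurable, `Φ` is INJECTIVE on `S` and maps measurable subsets of `S` to measurable sets.  Then **`μ∘Φ⁻¹ ≤ (m⁻¹ + 1)•μ` — NO factor `#K`**.
[cite: Helgason2000, Ch. I §1 Thm. 1.14 (13) p. 96] [cite: Balaban1987RG1, (0.4) p.253 (the consumer's shape; bookkeeping)] -/
theorem haar_map_le_of_windows_injOn {Φ : G → G} (hΦm : Measurable Φ)
    {S : Set G} (hSm : MeasurableSet S) (heq : ∀ x, x ∉ S → Φ x = x)
    (hinj : InjOn Φ S) (himg : ∀ E, E ⊆ S → MeasurableSet E → MeasurableSet (Φ '' E))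
    {s : ℝ} (hs0 : 0 < s) (hs : s ≤ chartRadius C)
    {ι : Type*} (K : Finset ι) (w₀ w₁ : ι → G) (Ω : ι → Set C.lie)
    (hΩ : ∀ k ∈ K, MeasurableSet (Ω k)) (hΩs : ∀ k ∈ K, Ω k ⊆ Metric.ball (0 : C.lie) s)
    (hVm : ∀ k ∈ K, MeasurableSet ((fun x => (w₀ k)⁻¹ * x) ⁻¹' (h.expChart '' Ω k)))
    (hjac : ∀ k ∈ K, ∀ X ∈ Ω k, LinearMap.det (jac hlie X : C.lie →ₗ[ℝ] C.lie) ≠ 0)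
    (ψ : ι → C.lie → C.lie) (ψ' : ι → C.lie → C.lie →L[ℝ] C.lie)
    (hψ' : ∀ k ∈ K, ∀ X ∈ Ω k, HasFDerivWithinAt (ψ k) (ψ' k X) (Ω k) X) (hψ : ∀ k ∈ K, Set.InjOn (ψ k) (Ω k))
    (hψs : ∀ k ∈ K, Set.MapsTo (ψ k) (Ω k) (Metric.ball (0 : C.lie) s))
    (hΨ : ∀ k ∈ K, ∀ X ∈ Ω k, (w₁ k)⁻¹ * Φ (w₀ k * h.expChart X) = h.expChart (ψ k X))
    {m : ℝ≥0∞} (hm0 : m ≠ 0) (hmt : m ≠ ∞)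
    (hm : ∀ k ∈ K, ∀ X ∈ Ω k, m ≤ jacDensity hlie (ψ k X) * ENNReal.ofReal |(ψ' k X).det| / jacDensity hlie X)
    (hS : S ⊆ ⋃ k ∈ K, (fun x => (w₀ k)⁻¹ * x) ⁻¹' (h.expChart '' Ω k)) :
    μ.map Φ ≤ (m⁻¹ + 1) • μ :=
  map_le_smul_of_restrict μ hΦm measurable_id (by rw [Measure.map_id]) hSm heq
    (map_restrict_le_smul_of_injOn μ K (fun k => (fun x => (w₀ k)⁻¹ * x) ⁻¹' (h.expChart '' Ω k)) hVm hΦm hm0 hmt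
      (fun k hk _ hB => mul_haar_translate_inter_preimage_le h hlie μ hs0 hs (hΩ k hk) (hΩs k hk) (hjac k hk) hΦm (w₀ k) (w₁ k)
        (hψ' k hk) (hψ k hk) (hψs k hk) (hΨ k hk) (hm k hk) hB) hSm hinj himg hS)

end Frame

/-! ## §3 The law of the printed core map on `SU(N)` under Haar, with the EXPLICIT constant `(1 − Σcᵢ)^{−(N²−1)} + 1` -/

section Generic

open Literature.MathematicalPhysics.QuantumFieldTheory (haarProbability)
open Literature.MathematicalPhysics.QuantumFieldTheory.Balaban1983to89
open Literature.MathematicalPhysics.QuantumFieldTheory.Balaban1983to89.HaarExponentialChart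
open Literature.MathematicalPhysics.QuantumFieldTheory.Balaban1983to89.HaarExponentialChart.IsChartRep (chartRadius innerRadius chartRadius_pos innerRadius_pos)
open Literature.MathematicalPhysics.QuantumFieldTheory.Balaban1983to89.T4EMLTangentInjective (Kmat emlD)
open Literature.MathematicalPhysics.QuantumFieldTheory.Balaban1983to89.ExpMeanLog (deltaSU lt_third_of_lt_deltaSU)
open Literature.MathematicalPhysics.QuantumFieldTheory.Balaban1983to89.MatrixLog (mlog)
open Literature.MathematicalPhysics.QuantumLattice (fundamentalRep fundamentalRep_apply)
open Summit.QuantumFields.YangMills.BalabanUVNodes.N08HaarCompatibilityGuardIntrinsicJacobian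
open Summit.QuantumFields.YangMills.BalabanUVNodes.N08HaarCompatibilityGuardCoreWindowLipschitzSUN
open Summit.QuantumFields.YangMills.BalabanUVNodes.N08HaarCompatibilityGuardCoreChartConjugateSUN
open Summit.QuantumFields.YangMills.BalabanUVNodes.N08HaarCompatibilityGuardInjectivityWindows (uniform_injectivity_windows exists_bound_emlD exists_norm_exp_sub_one_lt)
open Summit.QuantumFields.YangMills.BalabanUVNodes.N08HaarCompatibilityGuardCoreLawSUN (norm_coe_inv_mul_sub_one_lt)
open Summit.QuantumFields.YangMills.BalabanUVNodes.N08HaarCompatibilityGuardMonotoneInjectiveSUNSlot (injOn_of_eq_kmat_deltaSU)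

variable {N : ℕ} [NeZero N] {ι : Type*} [Fintype ι]

/-- ★★★ **THE LAW OF THE PRINTED CORE MAP ON `SU(N)` UNDER HAAR IS `≤ ((1 − Σcᵢ)^{−(N²−1)} + 1)•HAAR` — EXPLICIT, EVERY `N`.**  For weights `cᵢ ≥ 0`,
`Σcᵢ ≤ 1 − 1∕300`, every family `V : ι → SU(N)`, every OPEN set `O` of guarded points (`‖Vᵢw* − 1‖ < deltaSU`) and every Borel `Φ : SU(N) → SU(N)` with
`Φ = Kmat V c` on `O` and `Φ = id` off `O`.  PROOF = g5's `exists_map_haar_le_of_kmat_on_open` verbatim (uniform radii, finite translated-window cover,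
a guarded centre in every piece, the chart conjugates and their Jacobian floor `(1 − Σcᵢ)^{N²−1}`) fed to the INJECTIVE frame of §2 instead of the counting
frame: `Φ` is injective on `O` by part (v-a) (`injOn_of_eq_kmat_deltaSU`), continuous there (`hasStrictFDerivAt_Kmat`), so its images of Borel subsets of `O`
are Borel (Lusin–Souslin, `MeasurableSet.image_of_continuousOn_injOn`), and the window pieces are open.
[cite: Balaban1987RG1, (0.4) p.253 (the typed averaging; bookkeeping)] -/
theorem map_haar_le_of_kmat_on_open (c : ι → ℝ) (hc0 : ∀ i, 0 ≤ c i) (hc3 : ∑ i, c i ≤ 1 - 1 / 300)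
    (V : ι → Matrix.specialUnitaryGroup (Fin N) ℂ) (Φ : Matrix.specialUnitaryGroup (Fin N) ℂ → Matrix.specialUnitaryGroup (Fin N) ℂ)
    (O : Set (Matrix.specialUnitaryGroup (Fin N) ℂ)) (hOo : IsOpen O) (hΦm : Measurable Φ)
    (hO : ∀ w ∈ O, ∀ i, ‖(V i : Matrix (Fin N) (Fin N) ℂ) * star (w : Matrix (Fin N) (Fin N) ℂ) - 1‖ < deltaSU (Fin N))
    (hΦ : ∀ w ∈ O, ((Φ w : Matrix.specialUnitaryGroup (Fin N) ℂ) : Matrix (Fin N) (Fin N) ℂ) =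
      Kmat (fun i => (V i : Matrix (Fin N) (Fin N) ℂ)) c (w : Matrix (Fin N) (Fin N) ℂ))
    (hid : ∀ w, w ∉ O → Φ w = w) :
    (haarProbability (Matrix.specialUnitaryGroup (Fin N) ℂ)).map Φ
      ≤ ((ENNReal.ofReal ((1 - ∑ i, c i) ^ (N ^ 2 - 1)))⁻¹ + 1) • haarProbability (Matrix.specialUnitaryGroup (Fin N) ℂ) := by
  classical
  have hc1 : ∑ i, c i < 1 := by linarith
  -- uniform radii
  obtain ⟨B, hB0, hB⟩ := exists_bound_emlD (m := Fin N) c (show (1 / 2 : ℝ) < 1 by norm_num)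
  obtain ⟨rₑ, hrₑ, hre⟩ := exists_norm_exp_sub_one_lt (m := Fin N) (show (0 : ℝ) < 1 / 6 by norm_num)
  obtain ⟨r₉, hr₉, h9⟩ := uniform_injectivity_windows (m := Fin N) c hc0 hc1 (show (1 / 3 : ℝ) < 1 / 2 by norm_num)
  obtain ⟨s₀, hs₀, hjacpos⟩ := exists_ball_det_jac_pos (lie_adStable_specialUnitaryGroup (n := Fin N))
  have hsC0 : 0 < chartRadius (specialUnitaryLogChart (Fin N)) := chartRadius_pos
  have hiC0 : 0 < innerRadius (specialUnitaryLogChart (Fin N)) := innerRadius_pos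
  set s : ℝ := min s₀ (chartRadius (specialUnitaryLogChart (Fin N))) with hs_def
  have hs0 : 0 < s := lt_min hs₀ hsC0
  have hsC : s ≤ chartRadius (specialUnitaryLogChart (Fin N)) := min_le_right _ _
  have hss₀ : s ≤ s₀ := min_le_left _ _
  set r : ℝ := min (min (min (1 / 2) rₑ) (min r₉ s)) (min (innerRadius (specialUnitaryLogChart (Fin N)) / (2 * B)) (s / (4 * B))) with hr_def
  have hr0 : 0 < r := by positivity
  have hr2 : r ≤ 1 / 2 := (min_le_left _ _).trans ((min_le_left _ _).trans (min_le_left _ _))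
  have hrre : r ≤ rₑ := (min_le_left _ _).trans ((min_le_left _ _).trans (min_le_right _ _))
  have hrr₉ : r ≤ r₉ := (min_le_left _ _).trans ((min_le_right _ _).trans (min_le_left _ _))
  have hrs' : r ≤ s := (min_le_left _ _).trans ((min_le_right _ _).trans (min_le_right _ _))
  have hrB : 2 * B * r ≤ innerRadius (specialUnitaryLogChart (Fin N)) := by
    have h1 : r ≤ innerRadius (specialUnitaryLogChart (Fin N)) / (2 * B) := (min_le_right _ _).trans (min_le_left _ _)
    rw [le_div_iff₀ (by positivity)] at h1; linarith
  have hrs : 4 * B * r ≤ s := by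
    have h1 : r ≤ s / (4 * B) := (min_le_right _ _).trans (min_le_right _ _)
    rw [le_div_iff₀ (by positivity)] at h1; linarith
  have hre' : ∀ Z : Matrix (Fin N) (Fin N) ℂ, ‖Z‖ < r → ‖exp Z - 1‖ < 1 / 6 := fun Z hZ => hre Z (hZ.trans_le hrre)
  -- the cover radius and the finite cover
  set η : ℝ := min (innerRadius (specialUnitaryLogChart (Fin N))) r / 5 with hη_def
  have hη0 : 0 < η := by positivity
  have hηi : 2 * η < innerRadius (specialUnitaryLogChart (Fin N)) := by
    have := min_le_left (innerRadius (specialUnitaryLogChart (Fin N))) r; rw [hη_def]; linarith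
  have hηr : 4 * η < r := by
    have := min_le_right (innerRadius (specialUnitaryLogChart (Fin N))) r; rw [hη_def]; linarith
  obtain ⟨r₁', hr₁', hη⟩ := exists_norm_exp_sub_one_lt (m := Fin N) hη0
  set r₁ : ℝ := min r₁' (chartRadius (specialUnitaryLogChart (Fin N))) with hr₁_def
  have hr₁0 : 0 < r₁ := lt_min hr₁' hsC0
  have hr₁C : r₁ ≤ chartRadius (specialUnitaryLogChart (Fin N)) := min_le_right _ _
  obtain ⟨t, ht⟩ := exists_finset_cover_translate_window (isChartRep_specialUnitaryGroup (n := Fin N)) hr₁0 hr₁C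
  -- the constant
  set m : ℝ≥0∞ := ENNReal.ofReal ((1 - ∑ i, c i) ^ (N ^ 2 - 1)) with hm_def
  have hm0 : m ≠ 0 := (ENNReal.ofReal_pos.2 (pow_pos (by linarith) _)).ne'
  have hmt : m ≠ ∞ := ENNReal.ofReal_ne_top
  have hVu : ∀ i, (V i : Matrix (Fin N) (Fin N) ℂ) ∈ Matrix.unitaryGroup (Fin N) ℂ := fun i => (Matrix.mem_specialUnitaryGroup_iff.mp (V i).2).1
  letI : MeasurableSpace (specialUnitaryLogChart (Fin N)).lie := borel _
  haveI : BorelSpace (specialUnitaryLogChart (Fin N)).lie := ⟨rfl⟩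
  -- a guarded centre in every window piece meeting `O`
  set Kf : Finset (Matrix.specialUnitaryGroup (Fin N) ℂ) :=
    t.filter (fun w => (O ∩ {x | w⁻¹ * x ∈ (isChartRep_specialUnitaryGroup (n := Fin N)).window r₁}).Nonempty) with hKf_def
  have hex : ∀ w ∈ Kf, ∃ W : Matrix.specialUnitaryGroup (Fin N) ℂ, W ∈ O ∩ {x | w⁻¹ * x ∈ (isChartRep_specialUnitaryGroup (n := Fin N)).window r₁} :=
    fun w hw => (Finset.mem_filter.1 hw).2
  choose! W₀ hW₀ using hex
  -- injectivity on `O` (part (v-a)), measurable images (Lusin–Souslin), measurable window pieces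
  have hinj : InjOn Φ O := injOn_of_eq_kmat_deltaSU V hc0 hc3 hO hΦ
  have hcont : ContinuousOn Φ O := by
    have hK : ContinuousOn (fun w : Matrix.specialUnitaryGroup (Fin N) ℂ =>
        Kmat (fun i => (V i : Matrix (Fin N) (Fin N) ℂ)) c (w : Matrix (Fin N) (Fin N) ℂ)) O := fun w hw =>
      ((T4EMLTangentInjective.hasStrictFDerivAt_Kmat _ c (fun i => (lt_third_of_lt_deltaSU (hO w hw i)).trans (by norm_num))).continuousAt.comp
        continuous_subtype_val.continuousAt).continuousWithinAt
    exact (Topology.IsInducing.subtypeVal.continuousOn_iff).2 (hK.congr fun w hw => hΦ w hw)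
  have himg : ∀ E, E ⊆ O → MeasurableSet E → MeasurableSet (Φ '' E) := fun E hE hEm =>
    hEm.image_of_continuousOn_injOn (hcont.mono hE) (hinj.mono hE)
  have hVm : ∀ w ∈ Kf, MeasurableSet ((fun x => (W₀ w)⁻¹ * x) ⁻¹' ((isChartRep_specialUnitaryGroup (n := Fin N)).expChart ''
      {X : (specialUnitaryLogChart (Fin N)).lie | ‖X‖ < r ∧ W₀ w * (isChartRep_specialUnitaryGroup (n := Fin N)).expChart X ∈ O})) := by
    intro w _
    have hrC : r ≤ chartRadius (specialUnitaryLogChart (Fin N)) := hrs'.trans hsC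
    have heq : (isChartRep_specialUnitaryGroup (n := Fin N)).expChart ''
        {X : (specialUnitaryLogChart (Fin N)).lie | ‖X‖ < r ∧ W₀ w * (isChartRep_specialUnitaryGroup (n := Fin N)).expChart X ∈ O}
        = (isChartRep_specialUnitaryGroup (n := Fin N)).window r ∩ {g | W₀ w * g ∈ O} := by
      ext g
      constructor
      · rintro ⟨X, ⟨hX, hXO⟩, rfl⟩
        exact ⟨(isChartRep_specialUnitaryGroup (n := Fin N)).expChart_mem_window (mem_ball_zero_iff.2 hX), hXO⟩
      · rintro ⟨hg, hgO⟩
        have hΘ := (isChartRep_specialUnitaryGroup (n := Fin N)).expChart_logChart_of_mem_window hrC hg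
        refine ⟨(isChartRep_specialUnitaryGroup (n := Fin N)).logChart g, ⟨?_, by rw [hΘ]; exact hgO⟩, hΘ⟩
        have := (isChartRep_specialUnitaryGroup (n := Fin N)).logChart_mem_ball hrC hg
        rwa [mem_ball_zero_iff] at this
    rw [heq]
    exact ((((isChartRep_specialUnitaryGroup (n := Fin N)).isOpen_window hrC).inter
      (hOo.preimage (continuous_const_mul _))).preimage (continuous_const_mul _)).measurableSet
  -- `O` is covered by the translated windows of the guarded centres
  have hS : O ⊆ ⋃ w ∈ Kf, (fun x => (W₀ w)⁻¹ * x) ⁻¹' ((isChartRep_specialUnitaryGroup (n := Fin N)).expChart ''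
      {X : (specialUnitaryLogChart (Fin N)).lie | ‖X‖ < r ∧ W₀ w * (isChartRep_specialUnitaryGroup (n := Fin N)).expChart X ∈ O}) := by
    intro x hx
    obtain ⟨w, hwt, hwx⟩ := ht x
    have hwK : w ∈ Kf := Finset.mem_filter.2 ⟨hwt, x, hx, hwx⟩
    obtain ⟨hW₀O, hW₀p⟩ := hW₀ w hwK
    obtain ⟨A, hA, hAe⟩ := hW₀p
    obtain ⟨Bv, hBv, hBe⟩ := hwx
    rw [mem_ball_zero_iff] at hA hBv
    have hg : (W₀ w)⁻¹ * x = ((isChartRep_specialUnitaryGroup (n := Fin N)).expChart A)⁻¹ * (isChartRep_specialUnitaryGroup (n := Fin N)).expChart Bv := by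
      rw [hAe, hBe]; group
    have hlt2 : ‖(((W₀ w)⁻¹ * x : Matrix.specialUnitaryGroup (Fin N) ℂ) : Matrix (Fin N) (Fin N) ℂ) - 1‖ < 2 * η := by
      rw [hg]
      exact norm_coe_inv_mul_sub_one_lt (hη _ (by rw [Submodule.norm_coe]; exact hA.trans_le (min_le_left _ _)))
        (hη _ (by rw [Submodule.norm_coe]; exact hBv.trans_le (min_le_left _ _)))
    have hlt : ‖fundamentalRep (Fin N) ((W₀ w)⁻¹ * x) - 1‖ < innerRadius (specialUnitaryLogChart (Fin N)) := by
      rw [fundamentalRep_apply]; exact hlt2.trans hηi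
    have hΘ : (isChartRep_specialUnitaryGroup (n := Fin N)).expChart ((isChartRep_specialUnitaryGroup (n := Fin N)).logChart ((W₀ w)⁻¹ * x)) = (W₀ w)⁻¹ * x :=
      (isChartRep_specialUnitaryGroup (n := Fin N)).expChart_logChart hlt
    have hXr : ‖(isChartRep_specialUnitaryGroup (n := Fin N)).logChart ((W₀ w)⁻¹ * x)‖ < r := by
      rw [← Submodule.norm_coe, (isChartRep_specialUnitaryGroup (n := Fin N)).coe_logChart hlt, fundamentalRep_apply]
      have hhalf : ‖(((W₀ w)⁻¹ * x : Matrix.specialUnitaryGroup (Fin N) ℂ) : Matrix (Fin N) (Fin N) ℂ) - 1‖ ≤ 1 / 2 :=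
        ((hlt2.trans hηi).trans_le IsChartRep.innerRadius_le_half).le
      calc ‖mlog (((W₀ w)⁻¹ * x : Matrix.specialUnitaryGroup (Fin N) ℂ) : Matrix (Fin N) (Fin N) ℂ)‖
          ≤ 2 * ‖(((W₀ w)⁻¹ * x : Matrix.specialUnitaryGroup (Fin N) ℂ) : Matrix (Fin N) (Fin N) ℂ) - 1‖ := MatrixLog.norm_mlog_le_two_mul hhalf
        _ ≤ 2 * (2 * η) := by gcongr
        _ < r := by linarith
    refine mem_iUnion₂.2 ⟨w, hwK, ?_⟩
    refine ⟨(isChartRep_specialUnitaryGroup (n := Fin N)).logChart ((W₀ w)⁻¹ * x), ⟨hXr, ?_⟩, hΘ⟩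
    rw [hΘ, mul_inv_cancel_left]; exact hx
  -- the frame
  exact haar_map_le_of_windows_injOn (isChartRep_specialUnitaryGroup (n := Fin N)) (lie_adStable_specialUnitaryGroup (n := Fin N))
    (haarProbability (Matrix.specialUnitaryGroup (Fin N) ℂ)) hΦm hOo.measurableSet hid hinj himg hs0 hsC Kf W₀ (fun w => Φ (W₀ w))
    (fun w => {X : (specialUnitaryLogChart (Fin N)).lie | ‖X‖ < r ∧ W₀ w * (isChartRep_specialUnitaryGroup (n := Fin N)).expChart X ∈ O})
    (fun w _ => (isOpen_windowSet (W₀ w) O hOo r).measurableSet)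
    (fun w _ X hX => mem_ball_zero_iff.2 (hX.1.trans_le hrs')) hVm
    (fun w _ X hX => (hjacpos X (hX.1.trans_le (hrs'.trans hss₀))).ne')
    (fun w X => (isChartRep_specialUnitaryGroup (n := Fin N)).logChart ((Φ (W₀ w))⁻¹ * Φ (W₀ w * (isChartRep_specialUnitaryGroup (n := Fin N)).expChart X)))
    (fun w X => fderiv ℝ (fun Y : (specialUnitaryLogChart (Fin N)).lie =>
      (isChartRep_specialUnitaryGroup (n := Fin N)).logChart ((Φ (W₀ w))⁻¹ * Φ (W₀ w * (isChartRep_specialUnitaryGroup (n := Fin N)).expChart Y))) X)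
    (fun w hw X hX => (differentiableAt_conj V c (W₀ w) Φ O hO hΦ (hW₀ w hw).1 hOo hB0 hB hr2 hre' hrB hX.1 hX.2).hasFDerivAt.hasFDerivWithinAt)
    (fun w hw => injOn_conj V c (W₀ w) Φ O hO hΦ (hW₀ w hw).1 hB0 hB hr2 hre' hrB hrr₉
      (h9 (fun i => (V i : Matrix (Fin N) (Fin N) ℂ)) (W₀ w : Matrix (Fin N) (Fin N) ℂ) hVu (Matrix.mem_specialUnitaryGroup_iff.mp (W₀ w).2).1
        (fun i => (lt_third_of_lt_deltaSU (hO (W₀ w) (hW₀ w hw).1 i)).le)).1)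
    (fun w hw X hX => mem_ball_zero_iff.2 (norm_conj_chart_lt V c (W₀ w) Φ O hO hΦ (hW₀ w hw).1 hB0 hB hr2 hre' hrB hrs hX.1 hX.2))
    (fun w hw X hX => semiconj V c (W₀ w) Φ O hO hΦ (hW₀ w hw).1 hB0 hB hr2 hre' hrB hX.1 hX.2) hm0 hmt
    (fun w hw X hX => jacobian_ge V c (W₀ w) Φ O hO hΦ (hW₀ w hw).1 hOo hB0 hB hr2 hre' hrB hc0 hc1.le hX.1 hX.2
      (hjacpos X (hX.1.trans_le (hrs'.trans hss₀))).ne') hS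

end Generic

end Summit.QuantumFields.YangMills.BalabanUVNodes.N08HaarCompatibilityGuardCoreLawSUNExplicit
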